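import Mathlib
import Literature.NumberTheory.Transcendental.BlochWignerDilogarithm
import Literature.NumberTheory.Transcendental.BlochWignerDilogarithmProofs
import Literature.NumberTheory.Transcendental.BlochWignerDistribution
import HarnessLib

/-!
# `ZagierDilogarithmConjecture` (stmt-KontsevichZagierPeriods-10550) — line
`kummer-clausen-linearisation` (reshape c4, "the cyclotomic sector, exactly"), stub
`stub_clausenCharSumLevel`

**Level raising for the Clausen character sum.** Let `ζ_N = exp(2πi/N)`, `D` the Bloch–Wigner
dilogarithm (`blochWignerDilog`) and, for a Dirichlet character `χ mod N`,
`Λ_N(χ) := Σ_{c mod N} χ(c) · D(ζ_N^c)` its Clausen character sum. For `χ mod M`, a prime `p` and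
the induced (imprimitive) character `χ↑ = changeLevel χ mod Mp`:

`Λ_{Mp}(χ↑) = (1/p − χ(p)) · Λ_M(χ)`.

Proof (finite character-sum combinatorics + the distribution relations of `D`).
* `χ↑(n) = 0` if `p ∣ n` and `χ↑(n) = χ(n)` otherwise (`ClausenLevel.changeLevel_natCast`), so
  `Λ_{Mp}(χ↑) = S − T` with `S = Σ_{n<Mp} χ(n) D(ζ_{Mp}^n)` and `T = Σ_{n<Mp, p ∣ n} χ(n) D(ζ_{Mp}^n)`.
* `S = Λ_M(χ)/p`: write `n = Mj + r` (`r < M`, `j < p`); `χ(Mj + r) = χ(r)` and the fibre sum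
  `Σ_{j<p} D(ζ_{Mp}^{Mj+r}) = D(ζ_M^r)/p` is the distribution relation `D(xᵖ) = p Σ_j D(ζ_pʲ x)`
  at `x = ζ_{Mp}^r`, `ζ_p = ζ_{Mp}^M` (`ClausenLevel.fibre_sum`).
* `T = χ(p) Λ_M(χ)`: write `n = pt + s` (`t < M`, `s < p`); only `s = 0` survives, `χ(pt) = χ(p)χ(t)`
  and `ζ_{Mp}^{pt} = ζ_M^t`.
The bookkeeping is isolated in the abstract `ClausenLevel.sum_level_aux`.
Mathlib + the tree's distribution file only; sorry-free; axioms ⊆ {propext, Classical.choice,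
Quot.sound}.

## References

* J. L. Dupont, *Scissors congruences, group homology and characteristic classes*, World
  Scientific (2001), Cor. 8.15 (distribution relations). [Dupont2001]
* J. Milnor, *Hyperbolic geometry: the first 150 years*, Bull. AMS 6 (1982) (Clausen/Lobachevsky
  values at rational multiples of `π`, Kubert identities). [Milnor1982]
-/

noncomputable section

open scoped BigOperators ComplexConjugate
open Literature.NumberTheory.Transcendental

namespace Summit.KontsevichZagierPeriods.HyperbolicBloch.ZagierDilogarithmCyclotomic

namespace ClausenLevel

/-! ### Finite-sum bookkeeping -/

/-- A sum over `ZMod N` is the sum over the representatives `0, …, N − 1`. [folklore] -/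
theorem sum_zmod_val_eq_sum_range {α : Type*} [AddCommMonoid α] (N : ℕ) [NeZero N]
    (F : ℕ → α) : ∑ c : ZMod N, F c.val = ∑ n ∈ Finset.range N, F n := by
  obtain ⟨n, rfl⟩ : ∃ n, N = n + 1 := Nat.exists_eq_succ_of_ne_zero (NeZero.ne N)
  exact Fin.sum_univ_eq_sum_range F (n + 1)

/-- A sum over `ZMod N` is the sum over the casts of `0, …, N − 1`. [folklore] -/
theorem sum_zmod_eq_sum_range {α : Type*} [AddCommMonoid α] (N : ℕ) [NeZero N]
    (G : ZMod N → α) : ∑ c : ZMod N, G c = ∑ n ∈ Finset.range N, G n := by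
  simpa only [ZMod.natCast_zmod_val] using sum_zmod_val_eq_sum_range N fun n => G n

/-- `Σ_{n < ab} F(n) = Σ_{i<a} Σ_{j<b} F(aj + i)` (division with remainder by `a`). [folklore] -/
theorem sum_range_mul_eq {α : Type*} [AddCommMonoid α] (a b : ℕ) (F : ℕ → α) :
    ∑ n ∈ Finset.range (a * b), F n =
      ∑ i ∈ Finset.range a, ∑ j ∈ Finset.range b, F (a * j + i) := by
  induction b with
  | zero => simp
  | succ b ih =>
    rw [mul_add_one, Finset.sum_range_add, ih, ← Finset.sum_add_distrib]
    refine Finset.sum_congr rfl fun i _ => ?_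
    rw [Finset.sum_range_succ]

/-- `Σ_{n < ab} F(n) = Σ_{s<b} Σ_{t<a} F(bt + s)` (division with remainder by `b`). [folklore] -/
theorem sum_range_mul_eq' {α : Type*} [AddCommMonoid α] (a b : ℕ) (F : ℕ → α) :
    ∑ n ∈ Finset.range (a * b), F n =
      ∑ s ∈ Finset.range b, ∑ t ∈ Finset.range a, F (b * t + s) := by
  rw [Nat.mul_comm]
  exact sum_range_mul_eq b a F

/-! ### The abstract level-raising identity -/

/-- **Abstract level raising.** If `ψ(n) = 𝟙[p ∤ n] χ(n)` on `ℤ/Mp`, the fibre sums of `F` over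
`ℤ/Mp → ℤ/M` are `G/p` and `F(pt) = G(t)`, then `Σ_{ℤ/Mp} ψ·F = (1/p − χ(p)) Σ_{ℤ/M} χ·G`. [folklore] -/
theorem sum_level_aux {M p : ℕ} [NeZero M] [NeZero (M * p)] (hp : p.Prime)
    (χ : DirichletCharacter ℂ M) (F G : ℕ → ℂ) (ψ : ZMod (M * p) → ℂ)
    (hψ : ∀ n : ℕ, ψ n = if p ∣ n then 0 else χ n)
    (hfib : ∀ r : ℕ, ∑ j ∈ Finset.range p, F (M * j + r) = (p : ℂ)⁻¹ * G r)
    (hFG : ∀ t : ℕ, F (p * t) = G t) :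
    ∑ c : ZMod (M * p), ψ c * F c.val = ((p : ℂ)⁻¹ - χ p) * ∑ c : ZMod M, χ c * G c.val := by
  rw [sum_zmod_eq_sum_range (M * p), sum_zmod_eq_sum_range M]
  have lhs : ∀ n ∈ Finset.range (M * p),
      ψ n * F (n : ZMod (M * p)).val = χ n * F n - (if p ∣ n then χ n * F n else 0) := by
    intro n hn
    rw [ZMod.val_cast_of_lt (Finset.mem_range.1 hn), hψ]
    split_ifs <;> ring
  have rhs : ∀ n ∈ Finset.range M, χ n * G (n : ZMod M).val = χ n * G n := by
    intro n hn
    rw [ZMod.val_cast_of_lt (Finset.mem_range.1 hn)]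
  rw [Finset.sum_congr rfl lhs, Finset.sum_congr rfl rhs, Finset.sum_sub_distrib]
  -- `S = Λ_M / p`
  have hS : ∑ n ∈ Finset.range (M * p), χ n * F n =
      (p : ℂ)⁻¹ * ∑ n ∈ Finset.range M, χ n * G n := by
    rw [sum_range_mul_eq M p, Finset.mul_sum]
    refine Finset.sum_congr rfl fun r _ => ?_
    have hχ : ∀ j : ℕ, χ ((M * j + r : ℕ) : ZMod M) = χ r := by
      intro j
      rw [Nat.cast_add, Nat.cast_mul, ZMod.natCast_self, zero_mul, zero_add]
    simp_rw [hχ]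
    rw [← Finset.mul_sum, hfib r]
    ring
  -- `T = χ(p) Λ_M`
  have hT : ∑ n ∈ Finset.range (M * p), (if p ∣ n then χ n * F n else 0) =
      χ p * ∑ n ∈ Finset.range M, χ n * G n := by
    rw [sum_range_mul_eq' M p, Finset.sum_eq_single_of_mem 0 (Finset.mem_range.2 hp.pos)]
    · simp only [add_zero, dvd_mul_right, ite_true]
      rw [Finset.mul_sum]
      refine Finset.sum_congr rfl fun t _ => ?_
      rw [Nat.cast_mul, map_mul, hFG, mul_assoc]
    · intro s hs hs0
      exact Finset.sum_eq_zero fun t _ => if_neg <|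
        (Nat.dvd_add_right (dvd_mul_right p t)).not.mpr
          (Nat.not_dvd_of_pos_of_lt (Nat.pos_of_ne_zero hs0) (Finset.mem_range.1 hs))
  rw [hS, hT]
  ring

/-! ### The three analytic inputs -/

/-- The induced character on natural numbers: `χ↑(n) = 0` if `p ∣ n`, `= χ(n)` otherwise (for
`p ∤ n`, `n` is a unit mod `Mp` iff it is a unit mod `M`). [folklore] -/
theorem changeLevel_natCast {M p : ℕ} [NeZero M] (hp : p.Prime) (χ : DirichletCharacter ℂ M)
    (n : ℕ) :
    DirichletCharacter.changeLevel (dvd_mul_right M p) χ (n : ZMod (M * p)) =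
      if p ∣ n then 0 else χ n := by
  split_ifs with hpn
  · refine MulChar.map_nonunit _ fun hu => hp.ne_one ?_
    exact ((ZMod.isUnit_iff_coprime n (M * p)).1 hu).coprime_mul_left_right.symm.eq_one_of_dvd
      hpn
  · by_cases hM : n.Coprime M
    · have hMp : n.Coprime (M * p) := hM.mul_right (hp.coprime_iff_not_dvd.2 hpn).symm
      have h := DirichletCharacter.changeLevel_eq_cast_of_dvd χ (dvd_mul_right M p)
        (ZMod.unitOfCoprime n hMp)
      simpa only [ZMod.coe_unitOfCoprime, dvd_mul_right, ZMod.cast_natCast] using h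
    · rw [MulChar.map_nonunit χ (mt (ZMod.isUnit_iff_coprime n M).1 hM),
        MulChar.map_nonunit (DirichletCharacter.changeLevel (dvd_mul_right M p) χ)
          (mt (ZMod.isUnit_iff_coprime n (M * p)).1 fun h => hM h.coprime_mul_right_right)]

/-- `ζ_{Mp}^p = ζ_M`. [folklore] -/
theorem cexp_level_pow (M : ℕ) {p : ℕ} (hp : p ≠ 0) :
    Complex.exp (2 * Real.pi * Complex.I / (M * p : ℕ)) ^ p =
      Complex.exp (2 * Real.pi * Complex.I / M) := by
  rw [← Complex.exp_nat_mul]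
  congr 1
  have hp' : (p : ℂ) ≠ 0 := Nat.cast_ne_zero.2 hp
  rw [Nat.cast_mul, mul_comm, div_mul_eq_mul_div, mul_div_mul_right _ _ hp']

/-- **The fibre sum** (distribution relation `D(xᵖ) = p Σ_{j<p} D(ζ_pʲ x)` at `x = ζ_{Mp}^r`,
`ζ_p = ζ_{Mp}^M`): `Σ_{j<p} D(ζ_{Mp}^{Mj + r}) = D(ζ_M^r)/p`. [cite: Dupont2001, Cor. 8.15] -/
theorem fibre_sum (M p : ℕ) [NeZero M] (hp : 0 < p) (r : ℕ) :
    ∑ j ∈ Finset.range p,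
        (blochWignerDilog
          (Complex.exp (2 * Real.pi * Complex.I / (M * p : ℕ)) ^ (M * j + r)) : ℂ) =
      (p : ℂ)⁻¹ * blochWignerDilog (Complex.exp (2 * Real.pi * Complex.I / M) ^ r) := by
  have hN : M * p ≠ 0 := mul_ne_zero (NeZero.ne M) hp.ne'
  have hζ : IsPrimitiveRoot (Complex.exp (2 * Real.pi * Complex.I / (M * p : ℕ)) ^ M) p :=
    (Complex.isPrimitiveRoot_exp (M * p) hN).pow (Nat.pos_of_ne_zero hN) rfl
  have key := blochWignerDilog_pow_distribution' hp hζ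
    (Complex.exp (2 * Real.pi * Complex.I / (M * p : ℕ)) ^ r)
  rw [← pow_mul, mul_comm r p, pow_mul, cexp_level_pow M hp.ne'] at key
  simp_rw [← pow_mul, ← pow_add] at key
  rw [key, Complex.ofReal_mul, Complex.ofReal_natCast, Complex.ofReal_sum,
    inv_mul_cancel_left₀ (Nat.cast_ne_zero.2 hp.ne' : (p : ℂ) ≠ 0)]

end ClausenLevel

/-- **Level raising for the Clausen character sum (c4 stub `stub_clausenCharSumLevel`).** For
`χ mod M`, a prime `p` and the induced character `χ↑ mod Mp`:
`Λ_{Mp}(χ↑) = (1/p − χ(p)) · Λ_M(χ)` — the fibres of `ℤ/Mp → ℤ/M` are summed by the distribution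
relation `D(xᵖ) = p Σ_{j<p} D(ζ_pʲ x)`, and the residues prime to `M` but not to `Mp` (present only
if `p ∤ M`) are `p·(ℤ/M)ˣ`, contributing `χ(p) Λ_M(χ)`. [cite: Dupont2001, Cor. 8.15] -/
theorem stub_clausenCharSumLevel :
    ∀ (M p : ℕ) [NeZero M] [NeZero (M * p)], p.Prime → ∀ χ : DirichletCharacter ℂ M,
      (∑ c : ZMod (M * p), DirichletCharacter.changeLevel (dvd_mul_right M p) χ c *
          (blochWignerDilog (Complex.exp (2 * Real.pi * Complex.I / (M * p : ℕ)) ^ c.val) : ℂ)) =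
        ((p : ℂ)⁻¹ - χ (p : ZMod M)) *
          ∑ c : ZMod M, χ c *
            (blochWignerDilog (Complex.exp (2 * Real.pi * Complex.I / M) ^ c.val) : ℂ) := by
  intro M p _ _ hp χ
  have hFG : ∀ t : ℕ,
      (blochWignerDilog (Complex.exp (2 * Real.pi * Complex.I / (M * p : ℕ)) ^ (p * t)) : ℂ) =
        blochWignerDilog (Complex.exp (2 * Real.pi * Complex.I / M) ^ t) := fun t => by
    rw [pow_mul, ClausenLevel.cexp_level_pow M hp.ne_zero]
  exact ClausenLevel.sum_level_aux hp χ
    (fun n => (blochWignerDilog (Complex.exp (2 * Real.pi * Complex.I / (M * p : ℕ)) ^ n) : ℂ))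
    (fun n => (blochWignerDilog (Complex.exp (2 * Real.pi * Complex.I / M) ^ n) : ℂ))
    (DirichletCharacter.changeLevel (dvd_mul_right M p) χ)
    (ClausenLevel.changeLevel_natCast hp χ) (ClausenLevel.fibre_sum M p hp.pos) hFG

end Summit.KontsevichZagierPeriods.HyperbolicBloch.ZagierDilogarithmCyclotomic

end
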